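import Mathlib.CategoryTheory.InducedCategory
import Mathlib.CategoryTheory.Category.ULift
import Literature.IUT.HodgeArakelov.RealifiedDFunctor
import HarnessLib

/-!
# [IUTchII] Cor 4.5 (ii) / Cor 4.10 (v): the functor `D^⊢ ↦ (D^⊩(D^⊢), Prime ⥲ V̲, {ρ_{D^⊩,v}})` valued in a SMALL model
# of the category of collections of data (universe bookkeeping for single-universe strip frames)

S. Mochizuki, *Inter-universal Teichmüller theory II*, kurims manuscript (Dec 2020), Cor 4.5 (ii) p. 132 l. 19–37 (the
functorial algorithm `‡D^⊢ ↦ (D^⊩(‡D^⊢), Prime(D^⊩(‡D^⊢)) ⥲ V̲, {‡ρ_{D^⊩,v}}_v)`), Cor 4.10 (v) p. 160 l. 77 – p. 161 l. 9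
("induces … an isomorphism of collections of data … compatible … with the `ℝ_{>0}`-orbits"); *III* (May 2020) Thm 1.5
(v) pp. 50–51. Own render `paper:url-5036b4059555`. Claim key `Mochizuki2012` DISPUTED (D-0012);
[cite: Mochizuki2012, Cor 4.5 (ii) p.132].

WHY THIS FILE (abc-iut cell, seat abc-iut-w4-d005; plan/GAP-LEDGER.md row G-w4d009-1, the L6-t3 merge debt
`BiCoricData.ofKits` of L6-lead §F v1.18n (1)). abc-iut-w4-d009 g2 typed the category of record `RlfData V`
(`RealifiedDataDegreeTorsor.lean`, p416964: objects = `V`-indexed pointed real lines + positive `ρ`-scalars, hom-sets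
= `ℝ_{>0}`-torsors) and Cor 4.5 (ii)'s functor `realifiedD line c hc : 𝒟 ⥤ RlfData V` on any category `𝒟` of
`D^⊢`-prime-strips (`RealifiedDFunctor.lean`, p417267), and proposed (INBOX 2026-08-26T02:46:02Z) that abc-iut-L6-t3's
kit-level bi-coric datum take `RFrob := AsSmall.{max 1 u} (RlfData V̲)`. UNIVERSES forbid that literally:
`RlfData.{u,w} V : Type (max u (w+1))` (the lines), so with L4-t3's `RLine.{u}` one gets `Type (u+1)`, while every
category of the single-universe frame `StripFrame.ofKits : StripFrame.{max 1 u}` must live in `Type (max 1 u)`. The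
standard fix (the pattern of this seat's landed witness `BiCoresRealifiedDFunctorWitness.lean`, p417751) is to put the
OBJECTS in `𝒟`'s universe — Mathlib's `InducedCategory`: same hom-sets as `RlfData V` between the images, so nothing
of the `ℝ_{>0}`-torsor structure (Cor 4.10 (v) p. 161) is lost. This file provides exactly those generic pieces, over
p417267 and Mathlib only (no kit import), so that the kit-level instantiation is one line each:

* `RlfImage line c hc := InducedCategory (RlfData V) (fun X : 𝒟 => (realifiedD line c hc).obj X)` (`Type u₁`, the
  universe of `𝒟`'s objects; `Category.{max u w}`); `rlfImage_exists_ne_id` (NOT rigid: `Aut ≅ ℝ_{>0}`),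
  `rlfImage_full_map_eq_orbit` (the full poly-isomorphism, read in `RlfData V`, IS the `ℝ_{>0}`-orbit of Cor 4.6 (ii) /
  4.10 (v));
* `realifiedDSmall line c hc : 𝒟 ⥤ RlfImage line c hc` — the lift of `realifiedD` (obj `X ↦ X`), with
  `realifiedDSmallForgetIso : realifiedDSmall ⋙ inducedFunctor _ ≅ realifiedD` (an identity) and the Cor 4.10 (v)
  consequences `realifiedDSmall_map_eq / _map_endo / _mapIso_eq_refl` ("induces AN isomorphism");
* the `AsSmall` layer for single-universe frames: `realifiedDAsSmall : AsSmall.{w'} 𝒟 ⥤ AsSmall.{w'} (RlfImage …)`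
  (= abc-iut-L6-t3's `liftF (realifiedDSmall …)`, spelled `AsSmall.down ⋙ _ ⋙ AsSmall.up`), `realifiedDAsSmall_mapIso_eq_refl`,
  the faithful reading `rlfReadingAsSmall := AsSmall.down ⋙ inducedFunctor _ : AsSmall (RlfImage …) ⥤ RlfData V`
  (`rlfReadingAsSmall_faithful`, a theorem — no instance is declared) and the identity
  `rlfReadingAsSmallIso : realifiedDAsSmall ⋙ rlfReadingAsSmall ≅ AsSmall.down ⋙ realifiedD line c hc` — i.e. precisely the
  triple `(Φ := AsSmall.down, U := rlfReadingAsSmall, η := rlfReadingAsSmallIso)` that this seat's proof-only bridge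
  `BiCoricData.thm15vSingleIso_of_realifiedD` (`BiCoresRealifiedDFunctor.lean`, p417639) consumes: a bi-coric datum
  with `RFrob := AsSmall (RlfImage line c hc)`, `realified := realifiedDAsSmall line c hc` satisfies [IUTchIII] Thm 1.5 (v)
  (`Thm15vSingleIso`) and `RealifiedRigidAt` at every pair, in one line.

HONEST FRAMING: category/universe bookkeeping over landed definitions; nothing here asserts a disputed claim or takes a
side on [IUTchIII] Cor 3.12; no new Prop fact; no instance, notation or attribute change.
-/

namespace Literature.IUT.HodgeArakelov

open CategoryTheory
open Literature.AnabelianGeometry.AbsoluteAnabelian Literature.IUT.HodgeTheaters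

universe u w v₁ u₁ w'

section Small

variable {V : Type u} {𝒟 : Type u₁} [Category.{v₁} 𝒟]
  (line : 𝒟 → V → RLine.{w}) (c : V → ℝ) (hc : ∀ v, 0 < c v)

/-- **IUTchII:Cor4.5(ii)** (kurims p. 132) the SMALL model of the category of collections of data
`(D^⊩(‡D^⊢), Prime ⥲ V̲, {‡ρ_{D^⊩,v}})` seen from a category `𝒟` of `D^⊢`-prime-strips: the category INDUCED on the objects
of `𝒟` by Cor 4.5 (ii)'s functor from abc-iut-w4-d009 g2's `RlfData V` (same hom-sets between the images; objects in
`𝒟`'s universe). [claim: Mochizuki2012, status: disputed] -/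
abbrev RlfImage : Type u₁ :=
  InducedCategory (RlfData.{u, w} V) (fun X : 𝒟 => (realifiedD line c hc).obj X)

/-- **IUTchII:Cor4.5(ii)** (kurims p. 132 l. 19–37) the functor `‡D^⊢ ↦ (D^⊩(‡D^⊢), Prime ⥲ V̲, {‡ρ_{D^⊩,v}})` VALUED IN
THE SMALL MODEL: on objects the identity of `𝒟`, on morphisms abc-iut-w4-d009 g2's `realifiedD` (degree `1`, THE
Frobenius-preserving line isomorphisms). [claim: Mochizuki2012, status: disputed] -/
noncomputable def realifiedDSmall : 𝒟 ⥤ RlfImage line c hc where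
  obj X := X
  map f := InducedCategory.homMk ((realifiedD line c hc).map f)
  map_id X := InducedCategory.hom_ext ((realifiedD line c hc).map_id X)
  map_comp f g := InducedCategory.hom_ext ((realifiedD line c hc).map_comp f g)

/-- **IUTchII:Cor4.5(ii)** (kurims p. 132) read back in `RlfData V` (the fully faithful induced functor), the small-model
functor IS `realifiedD` — on the nose. [claim: Mochizuki2012, status: disputed] -/
noncomputable def realifiedDSmallForgetIso :
    realifiedDSmall line c hc ⋙ inducedFunctor (fun X : 𝒟 => (realifiedD line c hc).obj X) ≅ realifiedD line c hc :=
  Iso.refl _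

/-- **IUTchII:Cor4.10(v)** (kurims p. 160 l. 77–81) PARALLEL morphisms of `D^⊢`-prime-strips induce the SAME morphism of
collections of data ("induces AN isomorphism"). [claim: Mochizuki2012, status: disputed] -/
theorem realifiedDSmall_map_eq {X Y : 𝒟} (f g : X ⟶ Y) :
    (realifiedDSmall line c hc).map f = (realifiedDSmall line c hc).map g :=
  InducedCategory.hom_ext (realifiedD_map_eq line c hc f g)

/-- **IUTchII:Cor4.10(v)** (kurims p. 160) `D^⊩(−)` sends every ENDOMORPHISM of a `D^⊢`-prime-strip to the identity.
[claim: Mochizuki2012, status: disputed] -/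
theorem realifiedDSmall_map_endo {X : 𝒟} (f : X ⟶ X) : (realifiedDSmall line c hc).map f = 𝟙 _ :=
  InducedCategory.hom_ext (realifiedD_map_endo line c hc f)

/-- **IUTchII:Cor4.10(v)** (kurims p. 160) / **IUTchIII:Thm1.5(v)** (p. 50) `D^⊩(−)` KILLS every automorphism of a
`D^⊢`-prime-strip (the shape plan/GAP-LEDGER.md G-w4d009-1 asks for). [claim: Mochizuki2012, status: disputed] -/
theorem realifiedDSmall_mapIso_eq_refl {X : 𝒟} (a : X ≅ X) : (realifiedDSmall line c hc).mapIso a = Iso.refl _ :=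
  Iso.ext (realifiedDSmall_map_endo line c hc a.hom)

/-- **IUTchII:Cor4.10(v)** (kurims p. 161 l. 30–33 "multiplying the arithmetic degrees by a given element `∈ ℝ_{>0}`") the
small model is NOT rigid: every object has the non-identity automorphism "dilate by `2`" (abc-iut-w4-d009 g2's
`RlfData.dilate_ne_id`) — the rigidity above is a property of the FUNCTOR. [claim: Mochizuki2012, status: disputed] -/
theorem rlfImage_exists_ne_id (X : RlfImage line c hc) : ∃ f : X ⟶ X, f ≠ 𝟙 X :=
  ⟨InducedCategory.homMk (((realifiedD line c hc).obj X).dilate 2 two_pos), fun h =>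
    RlfData.dilate_ne_id _ two_pos (by norm_num) (congrArg InducedCategory.Hom.hom h)⟩

/-- **IUTchII:Cor4.10(v)** (kurims p. 161 l. 3–9) the FULL poly-isomorphism between two objects of the small model, read
in `RlfData V`, IS the `ℝ_{>0}`-orbit of [IUTchII] Cor 4.6 (ii) (abc-iut-w4-d009 g2's `RlfData.orbit`, `orbit_eq_full`) —
so a Kummer datum typed as the full poly-isomorphism represents the printed orbit, not a quotient of it.
[claim: Mochizuki2012, status: disputed] -/
theorem rlfImage_full_map_eq_orbit (X Y : RlfImage line c hc)
    (κ : (realifiedD line c hc).obj X ≅ (realifiedD line c hc).obj Y) :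
    (PolyIso.full X Y).map (inducedFunctor (fun X : 𝒟 => (realifiedD line c hc).obj X)) = RlfData.orbit κ := by
  rw [RlfData.orbit_eq_full]
  exact PolyIso.map_full_of_fullyFaithful (fullyFaithfulInducedFunctor _) _ _

/-- **IUTchII:Cor4.6(ii)** (kurims p. 138) / **IUTchII:Cor4.5(ii)**: any two objects of the small model ARE isomorphic in
`RlfData V` (degree-`1` isomorphism), so the orbit of `rlfImage_full_map_eq_orbit` is available at every pair.
[claim: Mochizuki2012, status: disputed] -/
theorem rlfImage_nonempty_iso (X Y : RlfImage line c hc) : Nonempty (X ≅ Y) :=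
  ⟨InducedCategory.isoMk ((Groupoid.isoEquivHom _ _).symm (RlfData.Hom.ofDeg _ _ 1 one_pos))⟩

end Small

/-! ### The `AsSmall` layer: `RFrob := AsSmall (RlfImage …)`, `realified := AsSmall.down ⋙ realifiedDSmall ⋙ AsSmall.up` -/

section AsSmallLayer

variable {V : Type u} {𝒟 : Type u₁} [Category.{v₁} 𝒟]
  (line : 𝒟 → V → RLine.{w}) (c : V → ℝ) (hc : ∀ v, 0 < c v)

/-- **IUTchII:Cor4.5(ii)** (kurims p. 132) `D^⊢ ↦ (D^⊩(D^⊢), Prime ⥲ V̲, {ρ_{D^⊩,v}})` between the single-universe models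
`AsSmall.{w'} 𝒟 ⥤ AsSmall.{w'} (RlfImage …)` (abc-iut-L6-t3's `liftF` shape `AsSmall.down ⋙ _ ⋙ AsSmall.up`, for the
`realified` field of a kit-level `BiCoricData` over `StripFrame.ofKits`). [claim: Mochizuki2012, status: disputed] -/
noncomputable def realifiedDAsSmall : AsSmall.{w'} 𝒟 ⥤ AsSmall.{w'} (RlfImage line c hc) :=
  AsSmall.down ⋙ realifiedDSmall line c hc ⋙ AsSmall.up

/-- **IUTchII:Cor4.10(v)** (kurims p. 160) / **IUTchIII:Thm1.5(v)** (p. 50) in the single-universe model too, `D^⊩(−)` kills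
every automorphism of a `D^⊢`-prime-strip. [claim: Mochizuki2012, status: disputed] -/
theorem realifiedDAsSmall_mapIso_eq_refl {X : AsSmall.{w'} 𝒟} (a : X ≅ X) :
    (realifiedDAsSmall.{u, w, v₁, u₁, w'} line c hc).mapIso a = Iso.refl _ := by
  refine Iso.ext ?_
  change AsSmall.up.map ((realifiedDSmall line c hc).map (AsSmall.down.map a.hom)) = 𝟙 _
  rw [realifiedDSmall_map_endo, CategoryTheory.Functor.map_id]

/-- **IUTchII:Cor4.10(v)** (kurims p. 160) the faithful READING of the single-universe model in the category of record
`RlfData V` (the `U` of `BiCoricData.thm15vSingleIso_of_realifiedD`, p417639). [claim: Mochizuki2012, status: disputed] -/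
noncomputable abbrev rlfReadingAsSmall : AsSmall.{w'} (RlfImage line c hc) ⥤ RlfData.{u, w} V :=
  AsSmall.down ⋙ inducedFunctor (fun X : 𝒟 => (realifiedD line c hc).obj X)

/-- **IUTchII:Cor4.10(v)** (kurims p. 160) the reading is faithful (an equivalence followed by a fully faithful functor) —
stated as a theorem (no instance declared); consumers write `haveI := rlfReadingAsSmall_faithful …`.
[claim: Mochizuki2012, status: disputed] -/
theorem rlfReadingAsSmall_faithful : (rlfReadingAsSmall.{u, w, v₁, u₁, w'} line c hc).Faithful :=
  haveI : (AsSmall.down : AsSmall.{w'} (RlfImage line c hc) ⥤ RlfImage line c hc).Faithful :=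
    ⟨fun h => ULift.ext _ _ h⟩
  Functor.Faithful.comp _ _

/-- **IUTchII:Cor4.5(ii)** (kurims p. 132) read in `RlfData V`, the single-universe `D^⊩(−)` IS `realifiedD` after
`AsSmall.down` — on the nose (the `η` of `BiCoricData.thm15vSingleIso_of_realifiedD`, with `Φ := AsSmall.down`).
[claim: Mochizuki2012, status: disputed] -/
noncomputable def rlfReadingAsSmallIso :
    realifiedDAsSmall.{u, w, v₁, u₁, w'} line c hc ⋙ rlfReadingAsSmall line c hc ≅
      AsSmall.down ⋙ realifiedD line c hc :=
  Iso.refl _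

end AsSmallLayer

end Literature.IUT.HodgeArakelov
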